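import Summits.Parity.GeneralizedHardyLittlewood.Theses.LeeYangFibres
import Summits.Parity.GeneralizedHardyLittlewood.Theorems.LeeYangFibresAbsoluteUpgradeDipDefs
import Summits.Parity.GeneralizedHardyLittlewood.Theorems.LeeYangFibresAbsoluteUpgradeModGammaAssembly
import Summits.Parity.GeneralizedHardyLittlewood.Theorems.LeeYangFibresAbsoluteUpgradeModGammaEin
import Summits.Parity.GeneralizedHardyLittlewood.Theorems.LeeYangFibresAbsoluteUpgradeModGammaAsymp
import Summits.Parity.GeneralizedHardyLittlewood.Theorems.LeeYangFibresAbsoluteUpgradeModGammaInvariant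
import Summits.Parity.GeneralizedHardyLittlewood.Theorems.LeeYangFibresAbsoluteUpgradeModGammaAdjointEq
import Summits.Parity.GeneralizedHardyLittlewood.Theorems.LeeYangFibresAbsoluteUpgradeModGammaInvariantValue
import Summits.Parity.GeneralizedHardyLittlewood.Theorems.LeeYangFibresAbsoluteUpgradePencilChainZero
import Summits.Parity.GeneralizedHardyLittlewood.Theorems.LeeYangFibresAbsoluteUpgradePencilDisc
import Summits.Parity.GeneralizedHardyLittlewood.Theorems.LeeYangFibresAbsoluteUpgradeQuantClip
import Summits.Parity.GeneralizedHardyLittlewood.Theorems.LeeYangFibresAbsoluteUpgradeAnatomyAlong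
import Summits.Parity.GeneralizedHardyLittlewood.Theorems.LeeYangFibresAbsoluteUpgradeCellsToDimOne
import Summits.Parity.GeneralizedHardyLittlewood.Theorems.LeeYangFibresAbsoluteUpgradeSingularProductLogLog
import Summits.Parity.GeneralizedHardyLittlewood.Theorems.LeeYangFibresAbsoluteUpgradeIllusory
import Summits.Parity.GeneralizedHardyLittlewood.Theorems.LeeYangFibresModelCellFactsParityPoint
import HarnessLib

/-!
# Crux `AbsoluteUpgrade` (stmt-Parity-14116) — line `dip-margin-rate-exchange` (lead seat c1, skeleton v2.3 — every provable stub LANDED):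
# threshold clipping at divergent degree (the rate exchange)

`AbsoluteUpgrade := RelativeDimOne → DimOne` (route `LeeYangFibres`). Skeleton of the line
`dip-margin-rate-exchange` (idea card `Cruxes/AbsoluteUpgrade/Ideas/dip-margin-rate-exchange.md`, merged by the
triage panel with `clipping-rate-budget` [threshold version] and `divergent-degree-clipping`; TRIAGE-r1-1/2/3: pass;
planner skeleton `Lines/dip_margin_rate_exchange.lean`, 2026-08-16T09:38Z), as RESHAPED by the lead seat c1
(`prover-line-stmt-Parity-14116-c1-0`, cycle 1): the vocabulary now lives in the landed-or-pending Theorems file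
`LeeYangFibresAbsoluteUpgradeDipDefs.lean` (same namespace), the schedule is `U(N) = max 4 ⌊√(log log N)/2⌋`, the
margin stub is `MarginPoly` (threshold below every power, polynomial robustness) instead of `MarginExp`, and the
cell-level node is the sibling line's `NlcCellsAbsoluteClip.PrimeCellsAbsolute` (so `stub_cellsToDimOne` is ONE
registered stub serving both lines; `primeCellsAbsolute_iff` in the Defs file is the `rfl` bridge).

THE LINE. The residual of the route is EXACTLY the factor `sup_Ψ ∏_p β_p ≍ (log log N)^{t-1}` (LANDED both ways:
`Theorems.AbsoluteUpgrade.stub_singularProduct_le_loglog_pow`, p86331, and `exists_pair_singularProduct_ge_loglog`,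
p90245). Full real-rootedness of a fibre, read through the MODEL PENCIL `F_u(ζ) + θ F_u(-ζ)` of the Buchstab–Dickman
row `F_u = Σ_j I_{j+1}(u) ζ^j` (`cellDensity`), clips the odd Walsh amplitude of that fibre below the pencil's
real-rootedness threshold, which is below every power `u^{-m}` for `u ≥ u₀(m)` (`MarginPoly`); along the schedule
`u = U(N)` the clipped amplitude `U^{-m}`, `m = 2t`, beats `(log log N)^{t-1} ≤ (2U+2)^{2t-2}`, the prime cell comes
out with ABSOLUTE error `ε N / log^t N`, and partial summation with the landed singular-product bound gives `DimOne`.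

STUBS (registered with `ledger workitem stub-add`; each a genuine lemma of the line):
* `stub_fibreHyperbolicityAlong` — crux-2-strength INPUT (the `u`-uniform clause of `FibreHyperbolicity` along the
  schedule), guarded by the crux's own hypothesis `RelativeDimOne` (TRIAGE-r1-3). Promote-stub candidate.
* `stub_cellParityLawSaving` — crux-3-strength INPUT: the cell-parity law along the schedule with a `(log N)^{-δ}`
  saving (TRIAGE-r1-1/2/3), same guard. Promote-stub candidate.
* `stub_marginPoly` — PARITY-FREE, pure analysis on `cellDensity` (the lead's stub): the threshold of the model
  pencil is below every power of `u`, robustly; SPLIT (cycle 1) into the registered `stub_modGammaDisc : ModGammaDisc`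
  (mod-Gamma disc asymptotic of the row — the one analytic fact not in the tree) and `stub_pencilDisc : ModGammaDisc →
  MarginPoly` (zero transfer with the tree's maximum-modulus Rouché).
* `stub_anatomyAlong` — parity-free, provable (Alladi with rate, tree `CellRate` pattern): model cells at roughness
  `U(N)` follow `I_m(U) N/log N` to relative accuracy `e^{-U²}/8`, uniformly in `1 ≤ m < U`.
* `stub_quantClip` — provable real algebra + bookkeeping (the rate version of the PROVED `HyperbolicityClipsParity_proof`):
  law + hyperbolicity along the schedule + margin + anatomy ⟹ `PrimeCellsAbsolute`.
* `stub_cellsToDimOne` — provable (absolute version of the PROVED `cellsToRelativeDimOne_proof`); SHARED with line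
  `nlc-cells-absolute-clip` (same name, same signature).
* `AbsoluteUpgrade_of` — the composition, PROVED (pure logic), concluding the crux BY NAME.

DISPROOF USED (`Cruxes/AbsoluteUpgrade/Disproof.lean`, cdisprove cycle 1, read 2026-08-16T10:25Z): `not_upgradeSchema` /
`not_rateSchema` (any proof must use arithmetic on the high-mass systems beyond the black box `RelativeDimOne`; no
parametric rate exchange) — honoured: `RelativeDimOne` is INERT here (a guard only), the rate comes from the zero locus at
divergent degree (`stub_quantClip` uses H = fibre hyperbolicity at `stub_fibreHyperbolicityAlong`); `absShapeAt_of_rate`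
(§6: a rate beating the mass growth discharges the crux) is exactly what `stub_quantClip` + `stub_cellsToDimOne` deliver
with `r ≍ U(N)^{-m}`, `m ≍ (log log N)^{t-1} ≤ (2U+2)^{2t-2}`; `not_uniformMassBound` (§4) respected — S1's growing bound is
used, never a uniform mass bound; §1 (`not_absoluteUpgrade_iff`): building, not refuting. No `-- Targets` theorem names a
statement of this line (the disproof's §7 attacks line `Sketch`).
-/

noncomputable section

namespace Summit.Parity.GeneralizedHardyLittlewood.Cruxes.AbsoluteUpgrade.DipMarginRateExchange

open scoped BigOperators Classical
open Literature.NumberTheory.Sieve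
open Summit.Parity.GeneralizedHardyLittlewood.Theses.LeeYangFibres
open Summit.Parity.GeneralizedHardyLittlewood.Cruxes.ModelHyperbolicity.WindowChainTransport (cellDensity)
open Summit.Parity.GeneralizedHardyLittlewood.Theorems.AbsoluteUpgrade (stub_singularProduct_le_loglog_pow
  absoluteUpgrade_iff_guarded)

/-! ## Stubs -/

/-- **Stub (crux-2 strength; the `u`-uniform clause of `FibreHyperbolicity`).** Under the crux's own hypothesis
`RelativeDimOne` (free inside `AbsoluteUpgrade`; it kills every resonance of relative size `≥ ε`, in particular
Siegel zeros of unbounded quality — `noSiegelZeros_of_relativeDimOne`), fibre hyperbolicity holds along the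
schedule `u = U(N) = max 4 ⌊√(log log N)/2⌋`. Not derivable from crux 2 as filed (`∃ u ≥ u₀`, `N₀ = N₀(u)`): the rate
is posited. [cite: card:dip-margin-rate-exchange; LeeYang1952; BorceaBranden2009] -/
theorem stub_fibreHyperbolicityAlong : RelativeDimOne → FibreHyperbolicityAlong := by
  sorry

/-- **Stub (crux-3 strength; the rate-bearing clause of `CellParityLaw`).** Under `RelativeDimOne`, the
cell-parity law holds along the schedule with a `(log N)^{-δ}` saving, `δ = δ(t, L) > 0`.
[cite: BombieriAsymptoticSieve1976; FriedlanderIwaniecPisa1978; Alladi1982] -/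
theorem stub_cellParityLawSaving : RelativeDimOne → CellParityLawSaving := by
  sorry

/-! ### The adjoint method for `ModGammaDisc` (vocabulary `…ModGammaDefs.lean` p110074; assembly
`…ModGammaAssembly.lean` p112668, lead c1: `modGammaDisc_of_adjoint`, PROVED) — five registered analytic stubs -/

-- **Stub `mg_ein : MGEin`** — LANDED p111070 (Theorems/LeeYangFibresAbsoluteUpgradeModGammaEin.lean), imported above.
example : MGEin := mg_ein

-- **Stub `mg_adjointEq : MGEin → MGAdjointEq`** (the adjoint equation on the disc, by analytic continuation in z) — LANDED p114513
-- (Theorems/LeeYangFibresAbsoluteUpgradeModGammaAdjointEq.lean + Kernel p111828, Step p112234, HalfPlane p113315), imported above.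
example : MGEin → MGAdjointEq := mg_adjointEq

-- **Stub `mg_adjointAsymp : MGEin → MGAdjointAsymp`** (Watson asymptotics, uniform on the disc) — LANDED p111704
-- (Theorems/LeeYangFibresAbsoluteUpgradeModGammaAsymp.lean), imported above.
example : MGEin → MGAdjointAsymp := mg_adjointAsymp

-- **Stub `mg_invariantValue : MGEin → MGAdjointEq → MGInvariantValue`** (the invariant's value 1/Γ(1+z), by dominated convergence
-- and continuation in z) — LANDED p114665 (Theorems/LeeYangFibresAbsoluteUpgradeModGammaInvariantValue.lean + Aux p114517), imported above.
example : MGEin → MGAdjointEq → MGInvariantValue := mg_invariantValue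

-- **Stub `mg_invariantConst : MGAdjointEq → MGInvariantConst`** (constancy of ⟨K, g̃⟩ along the row) — LANDED p111665
-- (Theorems/LeeYangFibresAbsoluteUpgradeModGammaInvariant.lean), imported above.
example : MGAdjointEq → MGInvariantConst := mg_invariantConst

/-- **The lead's analytic stub, composed (parity-free; split 1/2 of the margin stub): the mod-Gamma disc asymptotic of
the Buchstab–Dickman row**, `Σ_{j<u} I_{j+1}(u) z^j = e^{-γz}(u-1)^z/Γ(1+z) + O_K((u-1)^{Re z}/u)` on `|z| ≤ K+1`
(`ModGammaDisc`), from the five adjoint-method stubs by the LANDED assembly `modGammaDisc_of_adjoint` (p112668: continuous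
induction + division by `v g̃`). [cite: Greaves2001, §4.2; Alladi1982; Tenenbaum2015, III.5–III.6] -/
theorem stub_modGammaDisc : ModGammaDisc :=
  modGammaDisc_of_adjoint (mg_adjointAsymp mg_ein) (mg_invariantValue mg_ein (mg_adjointEq mg_ein))
    (mg_invariantConst (mg_adjointEq mg_ein))

-- **Stub `pencil_chainZero : PencilChainZero`** (explicit non-real zero of the model pencil with a clearance circle) —
-- LANDED p113069 (Theorems/LeeYangFibresAbsoluteUpgradePencilChainZero.lean, + Aux p108017), imported above.
example : PencilChainZero := pencil_chainZero

-- **Stub `stub_pencilDiscOfChain : PencilChainZero → ModGammaDisc → MarginPoly`** (pencil zero transfer by the tree's max-modulus Rouché) —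
-- LANDED p113522 (Theorems/LeeYangFibresAbsoluteUpgradePencilDisc.lean, + Aux p111215, Aux2 p111270), imported above.
example : PencilChainZero → ModGammaDisc → MarginPoly := stub_pencilDiscOfChain

/-- **Stub (complex-analysis bookkeeping; split 2/2 of the lead's margin stub): pencil zero transfer.** From the disc
asymptotic: the model pencil `Q = M(z) + θM(-z)` has, for `u^{-m} ≤ |θ| ≤ 1`, a non-real zero `ζ` near the first killed
lobe (`Re ζ ≈ -k₁`, `0 < |Im ζ| < 1`), with `|Q| ≳ θ M(-Re ζ)/C` on a circle of radius `≍ 1/log u` about it; the row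
polynomial `Σ b_j z^j` is within `u^{-m-4}F_u(|z|) + u^{1-u}|z|^u + (model error)` of `Q` there, so the tree's
maximum-modulus Rouché `Literature.NumberTheory.LFunctions.exists_zero_of_norm_sub_lt` (UniversalityZeros.lean) puts a
zero of the row polynomial in that disc, off the real axis (`MarginPoly`). The exact-pencil count (interval property,
`θ*` = min over negative lobes of `max_L |F_u(x)|/F_u(-x)`) is the paper "pencil theorem" of the lead's notes §2.
[cite: Conway1978, Ch. VII Thm. 2.5] -/
theorem stub_pencilDisc : ModGammaDisc → MarginPoly := stub_pencilDiscOfChain pencil_chainZero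

/-- **The lead's margin stub, composed from its two registered halves** (`MarginPoly`): the real-rootedness
threshold of the Buchstab–Dickman pencil is below every power of the degree, robustly. -/
theorem stub_marginPoly : MarginPoly := stub_pencilDisc stub_modGammaDisc

-- **Stub (parity-free, PROVED p102212, Theorems/LeeYangFibresAbsoluteUpgradeAnatomyAlong.lean):** `stub_anatomyAlong : AnatomyAlong`.
example : AnatomyAlong := stub_anatomyAlong

-- **Stub `stub_quantClip`** (the RATE version of the proved clipping lemma: law + hyperbolicity along the schedule + margin +
-- anatomy ⟹ PrimeCellsAbsolute) — LANDED p114484 (Theorems/LeeYangFibresAbsoluteUpgradeQuantClip.lean, + Aux p106049, Fibre p111348,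
-- Numerics p111413, Scale p111461, Assembly p113188), imported above.
example : CellParityLawSaving → FibreHyperbolicityAlong → MarginPoly → AnatomyAlong →
    NlcCellsAbsoluteClip.PrimeCellsAbsolute := stub_quantClip

/-- **Stub (provable now; absolute version of `cellsToRelativeDimOne_proof`; SHARED with line
`nlc-cells-absolute-clip`).** Prime cells with absolute error give `DimOne`: sandwich with threshold
`Y = N/(log N)^{t+2}` and `η = η(N) ≍ ε/(t C(t,L)(log log N)^{t-1})`, PNT with rate, S1 for the main-term distortion.
[cite: GreenTao2010, Conj. 1.4 (sketch after (1.8)); MontgomeryVaughan2007, §8.1] -/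
theorem stub_cellsToDimOne : NlcCellsAbsoluteClip.PrimeCellsAbsolute → DimOne :=
  -- LANDED by lead seat 1's wave (Theorems/LeeYangFibresAbsoluteUpgradeCellsToDimOne.lean) — the shared node
  Summit.Parity.GeneralizedHardyLittlewood.Theorems.AbsoluteUpgrade.stub_cellsToDimOne

/-! ## Landed inputs the stubs lean on (kernel-checked, imported — no sorry) -/

/-- S1 (LANDED p86331): the exact size of the residual, `∏_p β_p ≤ C(t,L) (log log N)^{t-1}`. -/
example (t L : ℕ) (ht : 1 ≤ t) :
    ∃ C : ℝ, 0 < C ∧ ∃ N₀ : ℕ, ∀ N : ℕ, N₀ ≤ N → ∀ Ψ : Fin t → AffLinForm 1,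
      IsNondegenerateSystem Ψ → affLinSize Ψ N ≤ L →
        singularProduct Ψ ≤ C * Real.log (Real.log N) ^ (t - 1) :=
  stub_singularProduct_le_loglog_pow t L ht

/-- Limit parity balance of the rough-integer row (LANDED): `|Σ_{j≤M} (-1)^j I_j(M)| ≤ 1/(M-1)`. -/
example {M : ℕ} (hM : 2 ≤ M) :
    |∑ j ∈ Finset.Icc 1 M, (-1 : ℝ) ^ j * cellDensity (j - 1) M| ≤ 1 / ((M : ℝ) - 1) :=
  Summit.Parity.GeneralizedHardyLittlewood.Theorems.ModelCellFacts.abs_alternating_sum_le hM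

/-- Checked against the landed guard (Illusory, p89962): modulo the vendored Matomäki–Merikoski theorem the crux
IS its `NoSiegelZeros`-guarded form, so guarding the two rate stubs by `RelativeDimOne` loses nothing. -/
example (hMM : Literature.Barriers.Parity.MatomakiMerikoski2023_pairCorrelation) :
    AbsoluteUpgrade ↔ (Literature.NumberTheory.LFunctions.NoSiegelZeros → RelativeDimOne → DimOne) :=
  absoluteUpgrade_iff_guarded hMM

/-! ## Composition (proved, pure logic): the line closes the crux modulo its stubs -/

/-- **`AbsoluteUpgrade` from the six stubs.** Given `RelativeDimOne`, the two guarded inputs deliver fibre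
hyperbolicity and the law-with-saving along the schedule; `stub_quantClip` turns them, with the parity-free
`stub_marginPoly` and `stub_anatomyAlong`, into prime cells with absolute error; `stub_cellsToDimOne` gives
`DimOne`. Concludes the route declaration BY NAME. -/
theorem AbsoluteUpgrade_of : AbsoluteUpgrade := fun hR =>
  stub_cellsToDimOne
    (stub_quantClip (stub_cellParityLawSaving hR) (stub_fibreHyperbolicityAlong hR) stub_marginPoly
      stub_anatomyAlong)

end Summit.Parity.GeneralizedHardyLittlewood.Cruxes.AbsoluteUpgrade.DipMarginRateExchange

end
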